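import Summits.ResolutionOfSingularities.ResolutionOfSingularities.Theorems.FrobeniusLadderFRationalResolutionEtaleChartTwoStepModelScheme
import Summits.ResolutionOfSingularities.ResolutionOfSingularities.Theorems.HomologicalConductorPersistenceCompletionIsolatedTransfer
import Summits.ResolutionOfSingularities.ResolutionOfSingularities.Theorems.FrobeniusLadderFInjectiveMacaulayficationAdmissibleLocalCentre
import HarnessLib

/-!
# Crux `FrobeniusLadder.FRationalResolution` (stmt-ResolutionOfSingularities-15317), line `redirect`,
# stub `stub_diagonalizableQuotientResolution` — THE OFF-VERTEX REGULARITY OF THE MODEL (`hoff`) IS AUTOMATIC: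
# input (iii) of the naive two-step pipeline (MEMO-15317-leafhand2-g24 §2) DISCHARGED

The no-Galois two-step consumer `…EtaleChartTwoStepModelScheme.hloc_of_model_charts_etale_nhd` (p842996) takes, besides the
model isomorphism `e : (T_𝔳)^ ≃+* (𝒪_{Y,y})^` and the chart facts, the hypothesis
`hoff : Spec T` is regular at every prime `⊊ 𝔳` («isolated class»). It is a CONSEQUENCE of the other data: `x = φ y` is an
isolated singular point of `X` (finite singular locus ⇒ singular points are closed, so every proper generization of `x` is
regular), `φ` is étale (locally quasi-finite: a proper generization of `y` does not map to `φ y`; regularity is reflected), so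
`𝒪_{Y,y}` is an isolated singularity; `𝒪_{Y,y}` is essentially of finite type over a field, hence a G-ring, so its completion is an
isolated singularity (`…CompletionIsolatedTransfer.isIsolatedSingularity_adicCompletion_of_isLocalization_finiteType`); transport
along `e`; and `T → T_𝔳 → (T_𝔳)^` is a regular homomorphism (`T` of finite type over a field is a G-ring,
`Matsumura1987_32_6_cor_holds`, `IsGRing.isRegularHom_comp_completion`), along which regularity DESCENDS prime by prime
(`IsRegularHom.isRegularLocalRing_localization_iff`; every prime `t ⊊ 𝔳` lies under a prime `≠ 𝔪̂` of the faithfully flat `(T_𝔳)^`).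

* §1 `hoff_of_isIsolatedSingularity_adicCompletion` — ring level: `(T_𝔳)^` an isolated singularity ⇒ `hoff`;
  `hoff_of_ringEquiv_adicCompletion` — from `e : (T_𝔳)^ ≃+* R^` with `R` a local ring that is a localization of a finitely
  generated algebra over a field and an isolated singularity.
* §2 `eq_of_specializes_of_etale`, `mem_regularLocus_of_specializes_of_finite`, `isIsolatedSingularity_stalk_of_generizations`,
  `isIsolatedSingularity_stalk_of_etale` — scheme level: `𝒪_{Y,y}` is an isolated singularity.
* §3 ★★ `hoff_of_etale_nhd` — `hoff` for any model `T` of `(𝒪_{Y,y})^` at an étale neighbourhood of an isolated singular point.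
* §4 ★★★ `hloc_of_model_charts_etale_nhd'` / `hasResolution_of_model_charts_etale_nhd'` — the consumer WITHOUT `hoff`.

Honest label: hygiene / assembly toward ONE leaf stub (no stub, crux or summit closed). No definitions, no named facts, no sorry.
[cite: Matsumura1987, Thm. 23.7; §32 p. 256 and Remark 1 p. 260] [cite: Grothendieck1967, Cor. 17.9.3 (étale ⇒ quasi-finite)]
[cite: BahlekehHakimianSalarianTakahashi2015, Definition 2.2 (3)]
-/

noncomputable section

-- single-problem summit: the doubled namespace component is forced
set_option linter.dupNamespace false

open CategoryTheory AlgebraicGeometry TopologicalSpace IsLocalRing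
open Literature.AlgebraicGeometry.Resolution Literature.RingTheory.CohomologyAnnihilator
open Summit.ResolutionOfSingularities.ResolutionOfSingularities.Theorems.HomologicalConductor
open Summit.ResolutionOfSingularities.ResolutionOfSingularities.Theorems.FInjectiveMacaulayfication

namespace Summit.ResolutionOfSingularities.ResolutionOfSingularities.Theorems.FRationalResolution.ModelIsolatedOffVertex

/-! ## §1 Ring level: descent of isolatedness from `(T_𝔳)^` to `Spec T` near `𝔳` -/

/-- **`Spec T` is regular at every prime `⊊ 𝔳` as soon as `(T_𝔳)^` is an isolated singularity** (`T` of finite type over a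
field, `𝔳` maximal): `T → (T_𝔳)^` is a regular homomorphism, every prime `t ⊊ 𝔳` lies under a prime `𝔔 ≠ 𝔪̂` of the
faithfully flat `T_𝔳`-algebra `(T_𝔳)^`, and regularity of `(T_𝔳)^_𝔔` descends to `T_t`.
[cite: Matsumura1987, Thm. 23.7; §32 p. 256] -/
theorem hoff_of_isIsolatedSingularity_adicCompletion (κ : Type) [Field κ] {T : Type} [CommRing T] [Algebra κ T]
    [Algebra.FiniteType κ T] [IsNoetherianRing T] (𝔳 : Ideal T) [𝔳.IsMaximal]
    (hiso : IsIsolatedSingularity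
      (AdicCompletion (maximalIdeal (Localization.AtPrime 𝔳)) (Localization.AtPrime 𝔳))) :
    ∀ t : Spec (.of T), t.asIdeal ≤ 𝔳 → t.asIdeal ≠ 𝔳 → t ∈ Scheme.regularLocus (Spec (.of T)) := by
  have hT : IsGRing T := Matsumura1987_32_6_cor_holds.{0} κ T ‹_›
  set L := Localization.AtPrime 𝔳 with hL
  haveI : IsNoetherianRing L := IsLocalization.isNoetherianRing 𝔳.primeCompl L inferInstance
  set Ê := AdicCompletion (maximalIdeal L) L with hÊ
  haveI : IsNoetherianRing Ê := isNoetherianRing_adicCompletion_maximalIdeal _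
  have hreg : IsRegularHom T Ê := IsGRing.isRegularHom_comp_completion hT 𝔳 L
  haveI : Module.FaithfullyFlat L Ê := Module.FaithfullyFlat.of_flat_of_isLocalHom
  rintro ⟨q, hq⟩ hle hne
  change q ≤ 𝔳 at hle
  change q ≠ 𝔳 at hne
  -- `q L` is a prime of `L` below the maximal ideal, over `q`
  have hdisj : Disjoint (𝔳.primeCompl : Set T) (q : Set T) := by
    rw [Set.disjoint_left]
    intro a ha haq
    exact ha (hle haq)
  haveI hq' : (q.map (algebraMap T L)).IsPrime := IsLocalization.isPrime_of_isPrime_disjoint 𝔳.primeCompl L q hq hdisj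
  have hcomap : (q.map (algebraMap T L)).under T = q :=
    IsLocalization.under_map_of_isPrime_disjoint 𝔳.primeCompl L hq hdisj
  have hne' : q.map (algebraMap T L) ≠ maximalIdeal L := by
    intro h
    apply hne
    rw [← hcomap, h]
    exact IsLocalization.AtPrime.under_maximalIdeal L 𝔳
  -- a prime of `Ê` over it, not the maximal ideal
  obtain ⟨Q, hQ, hQO⟩ := Ideal.exists_isPrime_liesOver_of_faithfullyFlat (B := Ê) (q.map (algebraMap T L))
  have hQL : Q.under L = q.map (algebraMap T L) := hQO.over.symm
  have hQne : Q ≠ maximalIdeal Ê :=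
    CompletionIsolatedTransfer.ne_maximalIdeal_of_under_ne (by rw [hQL]; exact hne')
  have hQT : q = Q.under T := by
    rw [← Ideal.under_under (B := L) Q, hQL, hcomap]
  -- regularity of `Ê_Q`, descended
  have hregQ : IsRegularLocalRing (Localization.AtPrime Q) := hiso Q hQne
  subst hQT
  exact (SingularPointsOverVertex.mem_regularLocus_Spec_iff _).mpr ((hreg.isRegularLocalRing_localization_iff Q).mp hregQ)

/-- **`hoff` from a model isomorphism.** `T` of finite type over a field `κ`, `𝔳` maximal; `R` a local ring which is a
localization of a finitely generated algebra `A` over a field `k` and an isolated singularity; `e : (T_𝔳)^ ≃+* R^`. Then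
`Spec T` is regular at every prime `⊊ 𝔳`. [cite: Matsumura1987, Thm. 23.7; §32 Remark 1 p. 260] -/
theorem hoff_of_ringEquiv_adicCompletion (κ : Type) [Field κ] {T : Type} [CommRing T] [Algebra κ T]
    [Algebra.FiniteType κ T] (𝔳 : Ideal T) [𝔳.IsMaximal]
    {k : Type} [Field k] {A : Type} [CommRing A] [Algebra k A] (hA : Algebra.FiniteType k A) (U : Submonoid A)
    {R : Type} [CommRing R] [Algebra A R] (hU : IsLocalization U R) [IsNoetherianRing R] [IsLocalRing R]
    (hR : IsIsolatedSingularity R)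
    (e : AdicCompletion (maximalIdeal (Localization.AtPrime 𝔳)) (Localization.AtPrime 𝔳) ≃+*
      AdicCompletion (maximalIdeal R) R) :
    ∀ t : Spec (.of T), t.asIdeal ≤ 𝔳 → t.asIdeal ≠ 𝔳 → t ∈ Scheme.regularLocus (Spec (.of T)) := by
  haveI : IsNoetherianRing T := Algebra.FiniteType.isNoetherianRing κ T
  have h1 : IsIsolatedSingularity (AdicCompletion (maximalIdeal R) R) :=
    CompletionIsolatedTransfer.isIsolatedSingularity_adicCompletion_of_isLocalization_finiteType hA U hU hR
  -- transport along `e⁻¹`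
  set e' := e.symm with he'
  have h2 : IsIsolatedSingularity (AdicCompletion (maximalIdeal (Localization.AtPrime 𝔳)) (Localization.AtPrime 𝔳)) := by
    intro 𝔮 _ hne
    have hne' : 𝔮.comap e' ≠ maximalIdeal (AdicCompletion (maximalIdeal R) R) := by
      intro heq
      apply hne
      rw [← Ideal.map_comap_of_surjective e' e'.surjective 𝔮, heq]
      exact map_ringEquiv_maximalIdeal e'
    haveI := h1 (𝔮.comap e') hne'
    exact IsRegularLocalRing.of_ringEquiv <| IsLocalization.ringEquivOfRingEquiv
      (Localization.AtPrime (𝔮.comap e')) (Localization.AtPrime 𝔮) e' (e'.map_primeCompl_comap_eq 𝔮)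
  exact hoff_of_isIsolatedSingularity_adicCompletion κ 𝔳 h2

/-! ## §2 Scheme level: the local ring at an étale neighbourhood of an isolated singular point is an isolated singularity -/

/-- Étale morphisms are locally quasi-finite (unramified and essentially of finite type ⇒ quasi-finite, affine-locally).
[cite: Grothendieck1967, Cor. 17.9.3] -/
theorem locallyQuasiFinite_of_etale {X Y : Scheme.{0}} (φ : Y ⟶ X) [Etale φ] : LocallyQuasiFinite φ := by
  have hqf : ∀ {R S : Type} [CommRing R] [CommRing S] {f : R →+* S}, f.Etale → f.QuasiFinite := by
    intro R S _ _ f hf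
    algebraize [f]
    rw [RingHom.QuasiFinite]
    infer_instance
  have h : Etale φ := inferInstance
  rw [HasRingHomProperty.eq_affineLocally @Etale] at h
  rw [HasRingHomProperty.eq_affineLocally @LocallyQuasiFinite]
  exact affineLocally_le hqf _ h

/-- Along an étale morphism a PROPER generization of `y` does not map to `φ y` (the fibre is discrete).
[cite: Grothendieck1967, Cor. 17.9.3] -/
theorem eq_of_specializes_of_etale {X Y : Scheme.{0}} (φ : Y ⟶ X) [Etale φ] {y' y : Y} (h : y' ⤳ y)
    (he : φ y' = φ y) : y' = y := by
  haveI := locallyQuasiFinite_of_etale φ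
  exact (φ.isDiscrete_preimage_singleton (φ y)).eq_of_specializes h he rfl

/-- On a scheme locally of finite type over a field with finitely many singular points, every PROPER generization of a point
is regular (singular points are closed). [folklore] -/
theorem mem_regularLocus_of_specializes_of_finite (k : Type) [Field k] (X : Scheme.{0}) (f : X ⟶ Spec (.of k))
    [LocallyOfFiniteType f] (hfin : (Scheme.regularLocus X)ᶜ.Finite) {x' x : X} (h : x' ⤳ x) (hne : x' ≠ x) :
    x' ∈ Scheme.regularLocus X := by
  by_contra hx'
  have hcl : IsClosed ({x'} : Set X) := IsolatedClosed.isClosed_singleton_of_finite_singularLocus k X f hfin hx'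
  have hmem : x ∈ closure ({x'} : Set X) := specializes_iff_mem_closure.mp h
  rw [hcl.closure_eq, Set.mem_singleton_iff] at hmem
  exact hne hmem.symm

/-- **`𝒪_{Y,y}` is an isolated singularity when every proper generization of `y` is a regular point** (the regular locus of
`Spec 𝒪_{Y,y}` is the pull-back of that of `Y`). [folklore; cite: BahlekehHakimianSalarianTakahashi2015, Definition 2.2 (3)] -/
theorem isIsolatedSingularity_stalk_of_generizations {Y : Scheme.{0}} (y : Y)
    (hgen : ∀ y' : Y, y' ⤳ y → y' ≠ y → y' ∈ Scheme.regularLocus Y) :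
    IsIsolatedSingularity (Y.presheaf.stalk y) := by
  intro 𝔭 _ h𝔭
  set s : Spec (Y.presheaf.stalk y) := ⟨𝔭, inferInstance⟩ with hs
  have hs' : s ∈ Scheme.regularLocus (Spec (Y.presheaf.stalk y)) := by
    rw [AdmissibleLocalCentre.mem_regularLocus_Spec_stalk_iff]
    refine hgen _ ?_ ?_
    · have : Y.fromSpecStalk y s ∈ Set.range (Y.fromSpecStalk y) := ⟨s, rfl⟩
      rw [Scheme.range_fromSpecStalk] at this
      exact this
    · intro heq
      apply h𝔭
      have : s = closedPoint (Y.presheaf.stalk y) := by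
        apply (Y.fromSpecStalk y).isEmbedding.injective
        rw [Scheme.fromSpecStalk_closedPoint]
        exact heq
      exact congrArg PrimeSpectrum.asIdeal this
  exact (SingularPointsOverVertex.mem_regularLocus_Spec_iff (N := Y.presheaf.stalk y) s).mp hs'

/-- ★ **`𝒪_{Y,y}` is an isolated singularity at an étale neighbourhood `(Y, y) → (X, φ y)` of a point of a scheme locally of
finite type over a field with finitely many singular points.** [cite: Matsumura1987, Thm. 23.7] [cite: Grothendieck1967, Cor. 17.9.3] -/
theorem isIsolatedSingularity_stalk_of_etale (k : Type) [Field k] (X : Scheme.{0}) (f : X ⟶ Spec (.of k))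
    [LocallyOfFiniteType f] (hfin : (Scheme.regularLocus X)ᶜ.Finite) {Y : Scheme.{0}} (φ : Y ⟶ X) [Etale φ] (y : Y) :
    IsIsolatedSingularity (Y.presheaf.stalk y) := by
  haveI : IsLocallyNoetherian X := LocallyOfFiniteType.isLocallyNoetherian f
  haveI : LocallyOfFiniteType (φ ≫ f) := inferInstance
  haveI : IsLocallyNoetherian Y := LocallyOfFiniteType.isLocallyNoetherian (φ ≫ f)
  refine isIsolatedSingularity_stalk_of_generizations y fun y' hy' hne => ?_
  have hx' : φ y' ∈ Scheme.regularLocus X :=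
    mem_regularLocus_of_specializes_of_finite k X f hfin (hy'.map φ.continuous)
      fun he => hne (eq_of_specializes_of_etale φ hy' he)
  rw [Scheme.mem_regularLocus] at hx' ⊢
  exact (isRegularLocalRing_stalk_iff_of_etale φ y').mpr hx'

/-! ## §3 `hoff` for a model of `(𝒪_{Y,y})^` -/

/-- ★★ **THE OFF-VERTEX REGULARITY OF THE MODEL IS AUTOMATIC.** `X` locally of finite type over a field with finitely many
singular points, `φ : Y → X` étale, `y : Y`; `T` of finite type over a field `κ`, `𝔳` maximal, `e : (T_𝔳)^ ≃+* (𝒪_{Y,y})^`.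
Then `Spec T` is regular at every prime `⊊ 𝔳`. [cite: Matsumura1987, Thm. 23.7; §32 p. 256 and Remark 1 p. 260] -/
theorem hoff_of_etale_nhd (k : Type) [Field k] (X : Scheme.{0}) (f : X ⟶ Spec (.of k)) [LocallyOfFiniteType f]
    (hfin : (Scheme.regularLocus X)ᶜ.Finite) {Y : Scheme.{0}} (φ : Y ⟶ X) [Etale φ] (y : Y)
    (κ : Type) [Field κ] (T : Type) [CommRing T] [Algebra κ T] [Algebra.FiniteType κ T] (𝔳 : Ideal T) [𝔳.IsMaximal]
    (e : (AdicCompletion (maximalIdeal (Localization.AtPrime 𝔳)) (Localization.AtPrime 𝔳)) ≃+*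
      AdicCompletion (maximalIdeal (Y.presheaf.stalk y)) (Y.presheaf.stalk y)) :
    ∀ t : Spec (.of T), t.asIdeal ≤ 𝔳 → t.asIdeal ≠ 𝔳 → t ∈ Scheme.regularLocus (Spec (.of T)) := by
  haveI : IsLocallyNoetherian X := LocallyOfFiniteType.isLocallyNoetherian f
  haveI : LocallyOfFiniteType (φ ≫ f) := inferInstance
  haveI : IsLocallyNoetherian Y := LocallyOfFiniteType.isLocallyNoetherian (φ ≫ f)
  have hiso := isIsolatedSingularity_stalk_of_etale k X f hfin φ y
  -- an affine open `V ∋ y`, its `k`-algebra of sections (of finite type) and the stalk as a localization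
  obtain ⟨V, hV, hyV, -⟩ := exists_isAffineOpen_mem_and_subset (U := ⊤) (x := y) trivial
  obtain ⟨gk, hgk⟩ := Spec.map_surjective (hV.fromSpec ≫ φ ≫ f)
  letI : Algebra k Γ(Y, V) := gk.hom.toAlgebra
  have hft : Algebra.FiniteType k Γ(Y, V) := by
    have h1 : LocallyOfFiniteType (Spec.map gk) := by rw [hgk]; infer_instance
    rw [HasRingHomProperty.Spec_iff (P := @LocallyOfFiniteType)] at h1
    exact h1
  letI := Y.presheaf.algebra_section_stalk (⟨y, hyV⟩ : V)
  haveI := hV.isLocalization_stalk ⟨y, hyV⟩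
  exact hoff_of_ringEquiv_adicCompletion κ 𝔳 hft (hV.primeIdealOf ⟨y, hyV⟩).asIdeal.primeCompl
    (R := Y.presheaf.stalk y) inferInstance hiso e

/-! ## §4 The two-step consumer without `hoff` -/

/-- ★★★ **`hloc` FROM AN ÉTALE NEIGHBOURHOOD AND A MODEL OF ITS COMPLETE LOCAL RING — no off-vertex hypothesis.**
`…EtaleChartTwoStepModelScheme.hloc_of_model_charts_etale_nhd` with `hoff` discharged by `hoff_of_etale_nhd`.
[cite: Kollar2007, §2.2] [cite: Matsumura1987, Thm. 8.14; Thm. 23.7; §32] -/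
theorem hloc_of_model_charts_etale_nhd' (k : Type) [Field k] (X : Scheme.{0}) [IsIntegral X]
    (f : X ⟶ Spec (.of k)) [LocallyOfFiniteType f] (hfin : (Scheme.regularLocus X)ᶜ.Finite)
    {Y : Scheme.{0}} (φ : Y ⟶ X) [Etale φ] (y : Y) (hx : φ y ∉ Scheme.regularLocus X) (a : ℕ)
    (κ : Type) [Field κ] (T : Type) [CommRing T] [Algebra κ T] [Algebra.FiniteType κ T] (𝔳 : Ideal T) [𝔳.IsMaximal]
    (e : (AdicCompletion (maximalIdeal (Localization.AtPrime 𝔳)) (Localization.AtPrime 𝔳)) ≃+*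
      AdicCompletion (maximalIdeal (Y.presheaf.stalk y)) (Y.presheaf.stalk y))
    {n : ℕ} (x : Fin n → T) (hxv : 𝔳 ^ (a + 1) = Ideal.span (Set.range x))
    (hfinm : ∀ i : Fin n, {𝔫 : PrimeSpectrum (blowupAlgebra (𝔳 ^ (a + 1)) (x i)) |
      𝔳.map (algebraMap T (blowupAlgebra (𝔳 ^ (a + 1)) (x i))) ≤ 𝔫.asIdeal ∧
        ¬ IsRegularLocalRing (Localization.AtPrime 𝔫.asIdeal)}.Finite)
    (hmodel : ∀ (i : Fin n) (𝔫 : PrimeSpectrum (blowupAlgebra (𝔳 ^ (a + 1)) (x i))),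
      𝔳.map (algebraMap T (blowupAlgebra (𝔳 ^ (a + 1)) (x i))) ≤ 𝔫.asIdeal →
      ¬ IsRegularLocalRing (Localization.AtPrime 𝔫.asIdeal) →
      Scheme.IsRegular (affineBlowup (R := Localization.AtPrime 𝔫.asIdeal)
        (maximalIdeal (Localization.AtPrime 𝔫.asIdeal)))) :
    ∃ (W : X.Opens), φ y ∈ W ∧ (∀ t : X, t ∉ Scheme.regularLocus X → t ∈ W → t = φ y) ∧
      ∃ (Z : Scheme.{0}) (ρ : Z ⟶ W), IsProper ρ ∧ Scheme.IsRegular Z ∧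
        IsIso (ρ ∣_ (W.ι ⁻¹ᵁ ⟨Scheme.regularLocus X, isOpen_regularLocus_of_locallyOfFiniteType_field f⟩)) ∧
        Dense ((ρ ⁻¹ᵁ (W.ι ⁻¹ᵁ ⟨Scheme.regularLocus X,
          isOpen_regularLocus_of_locallyOfFiniteType_field f⟩) : Z.Opens) : Set Z) :=
  EtaleChartTwoStepModelScheme.hloc_of_model_charts_etale_nhd k X f hfin φ y hx a κ T 𝔳
    (hoff_of_etale_nhd k X f hfin φ y κ T 𝔳 e) e x hxv hfinm hmodel

/-- ★★★ **RESOLUTION WHEN EVERY SINGULAR POINT HAS AN ÉTALE NEIGHBOURHOOD WHOSE COMPLETE LOCAL RING HAS A MODEL RESOLVED BY THE NAIVE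
TWO-STEP RECIPE — no off-vertex hypothesis.** [cite: Kollar2007, §2.2] -/
theorem hasResolution_of_model_charts_etale_nhd' (k : Type) [Field k] (X : Scheme.{0}) [IsIntegral X]
    (f : X ⟶ Spec (.of k)) [LocallyOfFiniteType f] (hfin : (Scheme.regularLocus X)ᶜ.Finite)
    (hchart : ∀ s : X, s ∉ Scheme.regularLocus X →
      ∃ (Y : Scheme.{0}) (φ : Y ⟶ X) (_ : Etale φ) (y : Y) (a : ℕ)
        (κ : Type) (_ : Field κ) (T : Type) (_ : CommRing T) (_ : Algebra κ T) (_ : Algebra.FiniteType κ T)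
        (𝔳 : Ideal T) (_ : 𝔳.IsMaximal)
        (_ : (AdicCompletion (maximalIdeal (Localization.AtPrime 𝔳)) (Localization.AtPrime 𝔳)) ≃+*
          AdicCompletion (maximalIdeal (Y.presheaf.stalk y)) (Y.presheaf.stalk y))
        (n : ℕ) (x : Fin n → T) (_ : 𝔳 ^ (a + 1) = Ideal.span (Set.range x))
        (_ : ∀ i : Fin n, {𝔫 : PrimeSpectrum (blowupAlgebra (𝔳 ^ (a + 1)) (x i)) |
          𝔳.map (algebraMap T (blowupAlgebra (𝔳 ^ (a + 1)) (x i))) ≤ 𝔫.asIdeal ∧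
            ¬ IsRegularLocalRing (Localization.AtPrime 𝔫.asIdeal)}.Finite),
        φ y = s ∧
        ∀ (i : Fin n) (𝔫 : PrimeSpectrum (blowupAlgebra (𝔳 ^ (a + 1)) (x i))),
          𝔳.map (algebraMap T (blowupAlgebra (𝔳 ^ (a + 1)) (x i))) ≤ 𝔫.asIdeal →
          ¬ IsRegularLocalRing (Localization.AtPrime 𝔫.asIdeal) →
          Scheme.IsRegular (affineBlowup (R := Localization.AtPrime 𝔫.asIdeal)
            (maximalIdeal (Localization.AtPrime 𝔫.asIdeal)))) :
    Scheme.HasResolution X := by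
  refine IsolatedGlue.hasResolution_of_finite_singularLocus_of_local k X f hfin fun s hs => ?_
  obtain ⟨Y, φ, _, y, a, κ, _, T, _, _, _, 𝔳, _, e, n, x, hxv, hfinm, hys, hmodel⟩ := hchart s hs
  subst hys
  exact hloc_of_model_charts_etale_nhd' k X f hfin φ y hs a κ T 𝔳 e x hxv hfinm hmodel

end Summit.ResolutionOfSingularities.ResolutionOfSingularities.Theorems.FRationalResolution.ModelIsolatedOffVertex

end
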